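/-
Copyright (c) 2026. All rights reserved.
Released under Apache 2.0 license as described in the file LICENSE.
-/
import Literature.Probability.FitznerVanDerHofstad2017.SrwUTwoAxisCellsD10
import Literature.Probability.FitznerVanDerHofstad2017.SrwUZeroAxisCellsD10
import Literature.Probability.FitznerVanDerHofstad2017.SrwKTwoSupD10
import Literature.Probability.FitznerVanDerHofstad2017.SrwTUSupTableD10
import Literature.Probability.FitznerVanDerHofstad2017.SrwRegionSplitAxisCells
import Literature.Probability.FitznerVanDerHofstad2017.SrwTrigMajorantAtomClosures
import HarnessLib

/-!
# `sup` of `U_{n,l}(x; 10)` over `‖x‖₁ ≥ 2` / `‖x‖₁ ≥ 3` rebuilt from the KU-separated axis cells (`l ≤ 2`, `n = 3, 4`)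

Reproduction (what-if / input-certification lane at the SRW-table parameter `d := 10`) of the region suprema of
the simple-random-walk integral `U_{n,l}(x; d) = ∫ |D̂^{(x)}(k)| [D̂^{sin}(k)]² |D̂(k)|^l Ĉ(k)^n` of

* R. Fitzner, R. van der Hofstad, *Generalized approach to the non-backtracking lace expansion*,
  Probab. Theory Relat. Fields 169 (2017) 1041–1119, arXiv:1506.07969 — §3.3 (3.38) p. 1071 (the `U`-integral),
  §5.2 (5.9) p. 1091 (the Cauchy–Schwarz split `U_{n,l}(x) ≤ √V_{n,2l} · √L_n(x)`), (5.15)–(5.16) p. 1092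
  (monotonicity of `L_n` along an axis and in the number of non-zero coordinates), §5.1 p. 1093 (the region sups
  entering the bootstrap functions of the companion paper *Mean-field behavior for nearest-neighbor percolation in
  `d > 10`*, Electron. J. Probab. 22 (2017), arXiv:1506.07977, whose Mathematica notebooks are the primary source of
  the published `d = 11` verification).

What is reproduced here.  The tree's region tables `TUSupD10.uS2 n l` / `uS3 n l` bound `sup_{‖x‖₁ ≥ 2} U_{n,l}` /
`sup_{‖x‖₁ ≥ 3} U_{n,l}` by the node rules of `SrwTUSupTableD10` §3, in which every AXIS node `m e₁` is bounded by the
Cauchy–Schwarz split (5.9).  This module replaces the axis nodes `2 ≤ |m| ≤ 5` by the CELL bounds of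
`SrwUZeroAxisCellsD10` (`l = 0`, trigonometric class rows) and `SrwUTwoAxisCellsD10` (`l = 2`), the node `m = 2` at
`l = 1` by log-convexity in `l` between those two cells (`srwU_odd_le_cast`), keeps (5.9) for the far axis tail
(`|m| ≥ 6` at the node `6e₀` with the shell-law `L`-majorant `KTwoSupD10.w6 n 0`; `|m| ≥ 3` at `3e₀` for `l = 1`)
and for the cone / pair nodes (`L_n(1^r) ≤ wOnes n 0 r`, `L_n(2e₁+e₂) ≤ wTab n 0 e12`, `L_n(2e₁+2e₂) ≤ pdTab n 0`),
and assembles the region sup with the orbit-decomposition lemmas `srwU_le_of_axisFamily_nodeBounds_two_cast` /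
`…_three_cast` of `SrwRegionSplitAxisCells`.  Result: six hypothesis-free literals
`U_{3,2}, U_{4,2}, U_{3,1}, U_{4,1}` over `‖x‖₁ ≥ 2` and `U_{3,0}, U_{4,0}` over `‖x‖₁ ≥ 3`, each `0.3 %–3.9 %` below the
corresponding `uS2` / `uS3` entry (the binding constraint is named in each docstring).

LANE.  Unconditional real-analysis inequalities about `srwU 10 n l x`; not a certificate of record at any dimension;
no `NobleHypotheses` instance, no `…Of 10` / `…At 10` structure, no `MeanFieldD10*` statement is built or implied.
-/

set_option maxHeartbeats 1000000

namespace Literature.Probability.FitznerVanDerHofstad2017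

open _root_.MeasureTheory Finset
open scoped BigOperators

namespace USupKUSepD10

open KTUD10 KSupD10 TUSupD10 KTwoSupD10 UZeroCellD10 UTwoCellD10

/-! ### §0  Node suppliers: the far axis nodes `6e₀`, `3e₀`, the pair nodes, the cone comparison -/

/-- `6·1_{μ<1} = 6e₀ = vecOfParts 10 [6]`. [folklore] -/
private theorem us_six_smul_indicator : ((6 : ℤ) • indicatorVec (lowSet 10 1) : Fin 10 → ℤ) = vecOfParts 10 [6] := by
  decide +kernel

/-- `W_{n,j}(6e₀; 10) ≤ w6 n j` (`1 ≤ n ≤ 4`, `j ≤ 22`; the shell-law majorant of `KTwoSupD10`). [cite: FitznerVanDerHofstad2016NoBLE, (5.16) p. 1092, Rem. 5.1 p. 1090] -/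
private theorem us_srwW_six_le (n : ℕ) (hn1 : 1 ≤ n) (hn4 : n ≤ 4) (j : ℕ) (hj : j ≤ 22) :
    srwW 10 n j (vecOfParts 10 [6]) ≤ ((w6 n j : ℚ) : ℝ) := by
  have h := srwW_smul_lowSet_le_shellWTabQ_of_termBound (d := 10) (n := n) (by omega) j 6 1
    (B := fun a b => termDom n j ((6 : ℤ) • classVec 10 a b)) (fun a b _ => termDom_sound hn1 hn4 hj _)
  rwa [us_six_smul_indicator] at h

/-- `L_n(6e₀; 10) ≤ w6 n 0`. [cite: FitznerVanDerHofstad2016NoBLE, (5.16) p. 1092] -/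
private theorem us_srwL_six_le (n : ℕ) (hn1 : 1 ≤ n) (hn4 : n ≤ 4) :
    srwL 10 n (vecOfParts 10 [6]) ≤ ((w6 n 0 : ℚ) : ℝ) := by
  rw [← srwW_zero]
  exact us_srwW_six_le n hn1 hn4 0 (by norm_num)

/-- `3e₀ = vecOfParts 10 [3]` is the table point `e3`. [folklore] -/
private theorem us_vecOfParts_three : vecOfParts 10 [3] = Nd.pt .e3 := by decide +kernel

/-- `L_n(3e₀; 10) ≤ wTab n 0 e3`. [cite: FitznerVanDerHofstad2016NoBLE, (5.16) p. 1092] -/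
private theorem us_srwL_three_le {n : ℕ} (hn1 : 1 ≤ n) (hn : n ≤ 4) :
    srwL 10 n (vecOfParts 10 [3]) ≤ ((wTab n 0 .e3 : ℚ) : ℝ) := by
  rw [← srwW_zero, us_vecOfParts_three]
  exact wTab_valid .e3 hn1 hn (Nat.zero_le _)

/-- [folklore] -/
private theorem us_vecOfParts_two_two : vecOfParts 10 [2, 2] = Pi.single 0 2 + Pi.single 1 2 := by decide +kernel

/-- Equal absolute profiles give equal level-set counts. [folklore] -/
private theorem us_card_abs_eq_of_absProf_eq {z z' : Fin 10 → ℤ} (h : absProf z = absProf z') (v : ℤ) :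
    Fintype.card {μ // |z μ| = v} = Fintype.card {μ // |z' μ| = v} := by
  have key : ∀ w : Fin 10 → ℤ, Fintype.card {μ // |w μ| = v} = Multiset.card ((absProf w).filter (· = v)) := by
    intro w
    rw [Fintype.card_subtype, absProf, Multiset.filter_map, Multiset.card_map]
    rfl
  rw [key, key, h]

/-- `W_{n,j}(2e₁+e₂) = W_{n,j}(e₁+2e₂)` (same `W_d`-orbit). [cite: FitznerVanDerHofstad2016NoBLE, (5.16) p. 1092] -/
private theorem us_srwW_vecOfParts_two_one (n j : ℕ) :
    srwW 10 n j (vecOfParts 10 [2, 1]) = srwW 10 n j (Nd.pt .e12) := by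
  have hp : absProf (vecOfParts 10 [2, 1]) = absProf (Nd.pt .e12) := by decide +kernel
  obtain ⟨τ, hτ⟩ := exists_spAct_eq_of_card_abs_eq _ _ (us_card_abs_eq_of_absProf_eq hp)
  rw [← hτ, srwW_spAct]

/-- `L_n(2e₁+e₂; 10) ≤ wTab n 0 e12`. [cite: FitznerVanDerHofstad2016NoBLE, (5.16) p. 1092] -/
private theorem us_srwL_two_one_le {n : ℕ} (hn1 : 1 ≤ n) (hn : n ≤ 4) :
    srwL 10 n (vecOfParts 10 [2, 1]) ≤ ((wTab n 0 .e12 : ℚ) : ℝ) := by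
  rw [← srwW_zero, us_srwW_vecOfParts_two_one]
  exact wTab_valid .e12 hn1 hn (Nat.zero_le _)

/-- `L_n(2e₁+2e₂; 10) ≤ pdTab n 0`. [cite: FitznerVanDerHofstad2016NoBLE, (5.16) p. 1092] -/
private theorem us_srwL_two_two_le {n : ℕ} (hn1 : 1 ≤ n) (hn : n ≤ 4) :
    srwL 10 n (vecOfParts 10 [2, 2]) ≤ ((pdTab n 0 : ℚ) : ℝ) := by
  rw [← srwW_zero, us_vecOfParts_two_two]
  exact pdTab_valid hn1 hn (Nat.zero_le _)

/-- The cone `L`-literals decrease in `r`: `wOnes n 0 r ≤ wOnes n 0 2` (`2 ≤ r ≤ 10`, `n ≤ 4`). [folklore] -/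
private theorem us_wOnes_le_two : ∀ n ≤ 4, ∀ r ≤ 10, 2 ≤ r → wOnes n 0 r ≤ wOnes n 0 2 := by decide +kernel

/-- Common `L`-bound of the `‖x‖₁ ≥ 3` nodes: `max (wTab n 0 e12) (pdTab n 0) (wOnes n 0 3)`. [cite: FitznerVanDerHofstad2016NoBLE, (5.15)–(5.16) p. 1092] -/
def bThree (n : ℕ) : ℚ := max (max (wTab n 0 .e12) (pdTab n 0)) (wOnes n 0 3)

/-- [folklore] -/
private theorem us_wOnes_le_bThree : ∀ n ≤ 4, ∀ r ≤ 10, 3 ≤ r → wOnes n 0 r ≤ bThree n := by decide +kernel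

/-- `U_{n,l}` is `W_d`-invariant. [cite: FitznerVanDerHofstad2016NoBLE, (3.38) p. 1071] -/
private theorem uInv (n l : ℕ) : SpInvariant (srwU 10 n l) := fun τ x => srwU_spAct n l τ x


/-! ### §1  Far axis tails by (5.9) at a node -/

/-- **`U_{3,0}(m e_i; 10) ≤ 0.0168042` for every `|m| ≥ 6`** — the Cauchy–Schwarz split (5.9) `√V_{3,0} √L_3` at the node
`6e₀` (`V ≤ KTUD10.vUp 3 0`, `L_n(6e₀) ≤ KTwoSupD10.w6 n 0` (shell law)), moved down the axis by (5.15). [cite: FitznerVanDerHofstad2016NoBLE, §5.2 (5.9) p. 1091, (5.15)–(5.16) p. 1092] -/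
theorem srwU_zero_far6_d10_n3 (i : Fin 10) (m : ℤ) (hm : 6 ≤ m.natAbs) :
    srwU 10 3 0 (Pi.single i m) ≤ ((168042 / 10000000 : ℚ) : ℝ) :=
  srwU_axisFamily_of_seedBounds_cast (d := 10) (n := 3) (by norm_num) (by norm_num) 0 i 6
    (vUp_sound (n := 3) (by norm_num) (by norm_num) (l := 0) (by norm_num)) (us_srwL_six_le 3 (by norm_num) (by norm_num))
    (by norm_num) (by decide +kernel) m hm

/-- **`U_{4,0}(m e_i; 10) ≤ 0.0244540` for every `|m| ≥ 6`** — the Cauchy–Schwarz split (5.9) `√V_{4,0} √L_4` at the node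
`6e₀` (`V ≤ KTUD10.vUp 4 0`, `L_n(6e₀) ≤ KTwoSupD10.w6 n 0` (shell law)), moved down the axis by (5.15). [cite: FitznerVanDerHofstad2016NoBLE, §5.2 (5.9) p. 1091, (5.15)–(5.16) p. 1092] -/
theorem srwU_zero_far6_d10_n4 (i : Fin 10) (m : ℤ) (hm : 6 ≤ m.natAbs) :
    srwU 10 4 0 (Pi.single i m) ≤ ((244540 / 10000000 : ℚ) : ℝ) :=
  srwU_axisFamily_of_seedBounds_cast (d := 10) (n := 4) (by norm_num) (by norm_num) 0 i 6
    (vUp_sound (n := 4) (by norm_num) (by norm_num) (l := 0) (by norm_num)) (us_srwL_six_le 4 (by norm_num) (by norm_num))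
    (by norm_num) (by decide +kernel) m hm

/-- **`U_{3,2}(m e_i; 10) ≤ 0.0022779` for every `|m| ≥ 6`** — the Cauchy–Schwarz split (5.9) `√V_{3,4} √L_3` at the node
`6e₀` (`V ≤ KTUD10.vUp 3 2`, `L_n(6e₀) ≤ KTwoSupD10.w6 n 0` (shell law)), moved down the axis by (5.15). [cite: FitznerVanDerHofstad2016NoBLE, §5.2 (5.9) p. 1091, (5.15)–(5.16) p. 1092] -/
theorem srwU_two_far6_d10_n3 (i : Fin 10) (m : ℤ) (hm : 6 ≤ m.natAbs) :
    srwU 10 3 2 (Pi.single i m) ≤ ((22779 / 10000000 : ℚ) : ℝ) :=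
  srwU_axisFamily_of_seedBounds_cast (d := 10) (n := 3) (by norm_num) (by norm_num) 2 i 6
    (vUp_sound (n := 3) (by norm_num) (by norm_num) (l := 2) (by norm_num)) (us_srwL_six_le 3 (by norm_num) (by norm_num))
    (by norm_num) (by decide +kernel) m hm

/-- **`U_{4,2}(m e_i; 10) ≤ 0.0046019` for every `|m| ≥ 6`** — the Cauchy–Schwarz split (5.9) `√V_{4,4} √L_4` at the node
`6e₀` (`V ≤ KTUD10.vUp 4 2`, `L_n(6e₀) ≤ KTwoSupD10.w6 n 0` (shell law)), moved down the axis by (5.15). [cite: FitznerVanDerHofstad2016NoBLE, §5.2 (5.9) p. 1091, (5.15)–(5.16) p. 1092] -/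
theorem srwU_two_far6_d10_n4 (i : Fin 10) (m : ℤ) (hm : 6 ≤ m.natAbs) :
    srwU 10 4 2 (Pi.single i m) ≤ ((46019 / 10000000 : ℚ) : ℝ) :=
  srwU_axisFamily_of_seedBounds_cast (d := 10) (n := 4) (by norm_num) (by norm_num) 2 i 6
    (vUp_sound (n := 4) (by norm_num) (by norm_num) (l := 2) (by norm_num)) (us_srwL_six_le 4 (by norm_num) (by norm_num))
    (by norm_num) (by decide +kernel) m hm

/-- **`U_{3,1}(m e_i; 10) ≤ 0.0048781` for every `|m| ≥ 3`** — the Cauchy–Schwarz split (5.9) `√V_{3,2} √L_3` at the node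
`3e₀` (`V ≤ KTUD10.vUp 3 1`, `L_n(3e₀) ≤ wTab n 0 e3`), moved down the axis by (5.15). [cite: FitznerVanDerHofstad2016NoBLE, §5.2 (5.9) p. 1091, (5.15)–(5.16) p. 1092] -/
theorem srwU_one_far3_d10_n3 (i : Fin 10) (m : ℤ) (hm : 3 ≤ m.natAbs) :
    srwU 10 3 1 (Pi.single i m) ≤ ((48781 / 10000000 : ℚ) : ℝ) :=
  srwU_axisFamily_of_seedBounds_cast (d := 10) (n := 3) (by norm_num) (by norm_num) 1 i 3
    (vUp_sound (n := 3) (by norm_num) (by norm_num) (l := 1) (by norm_num)) (us_srwL_three_le (n := 3) (by norm_num) (by norm_num))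
    (by norm_num) (by decide +kernel) m hm

/-- **`U_{4,1}(m e_i; 10) ≤ 0.0088987` for every `|m| ≥ 3`** — the Cauchy–Schwarz split (5.9) `√V_{4,2} √L_4` at the node
`3e₀` (`V ≤ KTUD10.vUp 4 1`, `L_n(3e₀) ≤ wTab n 0 e3`), moved down the axis by (5.15). [cite: FitznerVanDerHofstad2016NoBLE, §5.2 (5.9) p. 1091, (5.15)–(5.16) p. 1092] -/
theorem srwU_one_far3_d10_n4 (i : Fin 10) (m : ℤ) (hm : 3 ≤ m.natAbs) :
    srwU 10 4 1 (Pi.single i m) ≤ ((88987 / 10000000 : ℚ) : ℝ) :=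
  srwU_axisFamily_of_seedBounds_cast (d := 10) (n := 4) (by norm_num) (by norm_num) 1 i 3
    (vUp_sound (n := 4) (by norm_num) (by norm_num) (l := 1) (by norm_num)) (us_srwL_three_le (n := 4) (by norm_num) (by norm_num))
    (by norm_num) (by decide +kernel) m hm

/-! ### §2  The axis node `2e_i` at `l = 1` by log-convexity in `l` -/

/-- **`U_{3,1}(2e_i; 10) ≤ 0.0049588`** by log-convexity in `l` between the axis cells `U_{3,0}(2e_i) ≤ 0.015970`
(`UZeroCellD10`) and `U_{3,2}(2e_i) ≤ 0.0015397` (`UTwoCellD10`): the least `10⁻⁷`-grid `c` with `a·b ≤ c²`.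
[cite: FitznerVanDerHofstad2016NoBLE, (3.38) p. 1071, §5.2 (5.9), (5.12) pp. 1091–1092] -/
theorem srwU_one_cell_d10_n3_m2 (i : Fin 10) :
    srwU 10 3 1 (Pi.single i 2) ≤ ((49588 / 10000000 : ℚ) : ℝ) :=
  srwU_odd_le_cast (d := 10) (n := 3) (by norm_num) 0 (srwU_zero_cell_d10_n3_m2 i) (srwU_two_cell_d10_n3_m2 i)
    (by norm_num) (by decide +kernel)

/-- **`U_{4,1}(2e_i; 10) ≤ 0.0093948`** by log-convexity in `l` between the axis cells `U_{4,0}(2e_i) ≤ 0.022814`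
(`UZeroCellD10`) and `U_{4,2}(2e_i) ≤ 0.0038687` (`UTwoCellD10`): the least `10⁻⁷`-grid `c` with `a·b ≤ c²`.
[cite: FitznerVanDerHofstad2016NoBLE, (3.38) p. 1071, §5.2 (5.9), (5.12) pp. 1091–1092] -/
theorem srwU_one_cell_d10_n4_m2 (i : Fin 10) :
    srwU 10 4 1 (Pi.single i 2) ≤ ((93948 / 10000000 : ℚ) : ℝ) :=
  srwU_odd_le_cast (d := 10) (n := 4) (by norm_num) 0 (srwU_zero_cell_d10_n4_m2 i) (srwU_two_cell_d10_n4_m2 i)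
    (by norm_num) (by decide +kernel)

/-! ### §3  The region sups -/

/-- **`U_{3,2}(x; 10) ≤ 0.0022779` whenever `Σ_μ |x_μ| ≥ 2`** (binding constraint: tail6; `TUSupD10.uS2 3 2` = 0.0023559,
-3.31 %).  Constraints: cell2 0.0015397, cell3 0.0014283, cell4 0.0014754, cell5 0.0014751, tail6 0.0022779, cone 0.0015782. [cite: FitznerVanDerHofstad2016NoBLE, (3.38) p. 1071, §5.2 (5.9) p. 1091, (5.15)–(5.16) p. 1092, §5.1 p. 1093] -/
theorem srwU_two_le_of_two_le_d10_n3 (x : Fin 10 → ℤ) (hx : 2 ≤ ∑ μ, |x μ|) :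
    srwU 10 3 2 x ≤ ((22779 / 10000000 : ℚ) : ℝ) := by
  have hax : ∀ m : ℤ, 2 ≤ m.natAbs → srwU 10 3 2 (Pi.single (0 : Fin 10) m) ≤ ((22779 / 10000000 : ℚ) : ℝ) :=
    axisFamily_of_cell_le_of_succ (uInv 3 2) 0 (m₀ := 2) (srwU_two_cell_d10_n3_m2 0)
      (Rat.cast_le.mpr (by norm_num)) <|
    axisFamily_of_cell_le_of_succ (uInv 3 2) 0 (m₀ := 3) (srwU_two_cell_d10_n3_m3 0)
      (Rat.cast_le.mpr (by norm_num)) <|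
    axisFamily_of_cell_le_of_succ (uInv 3 2) 0 (m₀ := 4) (srwU_two_cell_d10_n3_m4 0)
      (Rat.cast_le.mpr (by norm_num)) <|
    axisFamily_of_cell_le_of_succ (uInv 3 2) 0 (m₀ := 5) (srwU_two_cell_d10_n3_m5 0)
      (Rat.cast_le.mpr (by norm_num)) <|
    axisFamily_of_uniform_le (F := srwU 10 3 2) 0 (M := 6)
      (fun m hm => srwU_two_far6_d10_n3 0 m hm) (Rat.cast_le.mpr (by norm_num))
  have h := srwU_le_of_axisFamily_nodeBounds_two_cast (d := 10) (n := 3) (by norm_num) (by norm_num) 2 (0 : Fin 10)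
    (B := wOnes 3 0 2) (q := (22779 / 10000000 : ℚ)) hax (vUp_sound (n := 3) (by norm_num) (by norm_num) (l := 2) (by norm_num))
    (fun r hr2 hr => (srwL_classVec_le_wOnes (n := 3) (by norm_num) (by norm_num) hr2 hr).trans
      (Rat.cast_le.mpr (us_wOnes_le_two 3 (by norm_num) r hr hr2)))
    (by norm_num) (by decide +kernel) x hx
  simpa only [max_self] using h

/-- **`U_{4,2}(x; 10) ≤ 0.0051700` whenever `Σ_μ |x_μ| ≥ 2`** (binding constraint: cone; `TUSupD10.uS2 4 2` = 0.0053705,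
-3.73 %).  Constraints: cell2 0.0038687, cell3 0.0031303, cell4 0.0044276, cell5 0.0044158, tail6 0.0046019, cone 0.0051700. [cite: FitznerVanDerHofstad2016NoBLE, (3.38) p. 1071, §5.2 (5.9) p. 1091, (5.15)–(5.16) p. 1092, §5.1 p. 1093] -/
theorem srwU_two_le_of_two_le_d10_n4 (x : Fin 10 → ℤ) (hx : 2 ≤ ∑ μ, |x μ|) :
    srwU 10 4 2 x ≤ ((51700 / 10000000 : ℚ) : ℝ) := by
  have hax : ∀ m : ℤ, 2 ≤ m.natAbs → srwU 10 4 2 (Pi.single (0 : Fin 10) m) ≤ ((51700 / 10000000 : ℚ) : ℝ) :=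
    axisFamily_of_cell_le_of_succ (uInv 4 2) 0 (m₀ := 2) (srwU_two_cell_d10_n4_m2 0)
      (Rat.cast_le.mpr (by norm_num)) <|
    axisFamily_of_cell_le_of_succ (uInv 4 2) 0 (m₀ := 3) (srwU_two_cell_d10_n4_m3 0)
      (Rat.cast_le.mpr (by norm_num)) <|
    axisFamily_of_cell_le_of_succ (uInv 4 2) 0 (m₀ := 4) (srwU_two_cell_d10_n4_m4 0)
      (Rat.cast_le.mpr (by norm_num)) <|
    axisFamily_of_cell_le_of_succ (uInv 4 2) 0 (m₀ := 5) (srwU_two_cell_d10_n4_m5 0)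
      (Rat.cast_le.mpr (by norm_num)) <|
    axisFamily_of_uniform_le (F := srwU 10 4 2) 0 (M := 6)
      (fun m hm => srwU_two_far6_d10_n4 0 m hm) (Rat.cast_le.mpr (by norm_num))
  have h := srwU_le_of_axisFamily_nodeBounds_two_cast (d := 10) (n := 4) (by norm_num) (by norm_num) 2 (0 : Fin 10)
    (B := wOnes 4 0 2) (q := (51700 / 10000000 : ℚ)) hax (vUp_sound (n := 4) (by norm_num) (by norm_num) (l := 2) (by norm_num))
    (fun r hr2 hr => (srwL_classVec_le_wOnes (n := 4) (by norm_num) (by norm_num) hr2 hr).trans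
      (Rat.cast_le.mpr (us_wOnes_le_two 4 (by norm_num) r hr hr2)))
    (by norm_num) (by decide +kernel) x hx
  simpa only [max_self] using h

/-- **`U_{3,1}(x; 10) ≤ 0.0049588` whenever `Σ_μ |x_μ| ≥ 2`** (binding constraint: cell2odd; `TUSupD10.uS2 3 1` = 0.0050264,
-1.34 %).  Constraints: cell2odd 0.0049588, tail3 0.0048781, cone 0.0033671. [cite: FitznerVanDerHofstad2016NoBLE, (3.38) p. 1071, §5.2 (5.9) p. 1091, (5.15)–(5.16) p. 1092, §5.1 p. 1093] -/
theorem srwU_one_le_of_two_le_d10_n3 (x : Fin 10 → ℤ) (hx : 2 ≤ ∑ μ, |x μ|) :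
    srwU 10 3 1 x ≤ ((49588 / 10000000 : ℚ) : ℝ) := by
  have hax : ∀ m : ℤ, 2 ≤ m.natAbs → srwU 10 3 1 (Pi.single (0 : Fin 10) m) ≤ ((49588 / 10000000 : ℚ) : ℝ) :=
    axisFamily_of_cell_le_of_succ (uInv 3 1) 0 (m₀ := 2) (srwU_one_cell_d10_n3_m2 0)
      (Rat.cast_le.mpr (by norm_num)) <|
    axisFamily_of_uniform_le (F := srwU 10 3 1) 0 (M := 3)
      (fun m hm => srwU_one_far3_d10_n3 0 m hm) (Rat.cast_le.mpr (by norm_num))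
  have h := srwU_le_of_axisFamily_nodeBounds_two_cast (d := 10) (n := 3) (by norm_num) (by norm_num) 1 (0 : Fin 10)
    (B := wOnes 3 0 2) (q := (49588 / 10000000 : ℚ)) hax (vUp_sound (n := 3) (by norm_num) (by norm_num) (l := 1) (by norm_num))
    (fun r hr2 hr => (srwL_classVec_le_wOnes (n := 3) (by norm_num) (by norm_num) hr2 hr).trans
      (Rat.cast_le.mpr (us_wOnes_le_two 3 (by norm_num) r hr hr2)))
    (by norm_num) (by decide +kernel) x hx
  simpa only [max_self] using h

/-- **`U_{4,1}(x; 10) ≤ 0.0096101` whenever `Σ_μ |x_μ| ≥ 2`** (binding constraint: cone; `TUSupD10.uS2 4 1` = 0.0099829,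
-3.73 %).  Constraints: cell2odd 0.0093948, tail3 0.0088987, cone 0.0096101. [cite: FitznerVanDerHofstad2016NoBLE, (3.38) p. 1071, §5.2 (5.9) p. 1091, (5.15)–(5.16) p. 1092, §5.1 p. 1093] -/
theorem srwU_one_le_of_two_le_d10_n4 (x : Fin 10 → ℤ) (hx : 2 ≤ ∑ μ, |x μ|) :
    srwU 10 4 1 x ≤ ((96101 / 10000000 : ℚ) : ℝ) := by
  have hax : ∀ m : ℤ, 2 ≤ m.natAbs → srwU 10 4 1 (Pi.single (0 : Fin 10) m) ≤ ((96101 / 10000000 : ℚ) : ℝ) :=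
    axisFamily_of_cell_le_of_succ (uInv 4 1) 0 (m₀ := 2) (srwU_one_cell_d10_n4_m2 0)
      (Rat.cast_le.mpr (by norm_num)) <|
    axisFamily_of_uniform_le (F := srwU 10 4 1) 0 (M := 3)
      (fun m hm => srwU_one_far3_d10_n4 0 m hm) (Rat.cast_le.mpr (by norm_num))
  have h := srwU_le_of_axisFamily_nodeBounds_two_cast (d := 10) (n := 4) (by norm_num) (by norm_num) 1 (0 : Fin 10)
    (B := wOnes 4 0 2) (q := (96101 / 10000000 : ℚ)) hax (vUp_sound (n := 4) (by norm_num) (by norm_num) (l := 1) (by norm_num))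
    (fun r hr2 hr => (srwL_classVec_le_wOnes (n := 4) (by norm_num) (by norm_num) hr2 hr).trans
      (Rat.cast_le.mpr (us_wOnes_le_two 4 (by norm_num) r hr hr2)))
    (by norm_num) (by decide +kernel) x hx
  simpa only [max_self] using h

/-- **`U_{3,0}(x; 10) ≤ 0.0168042` whenever `Σ_μ |x_μ| ≥ 3`** (binding constraint: tail6; `TUSupD10.uS3 3 0` = 0.0168677,
-0.38 %).  Constraints: cell3 0.0158850, cell4 0.0159410, cell5 0.0159410, tail6 0.0168042, cone 0.0071036. [cite: FitznerVanDerHofstad2016NoBLE, (3.38) p. 1071, §5.2 (5.9) p. 1091, (5.15)–(5.16) p. 1092, §5.1 p. 1093] -/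
theorem srwU_zero_le_of_three_le_d10_n3 (x : Fin 10 → ℤ) (hx : 3 ≤ ∑ μ, |x μ|) :
    srwU 10 3 0 x ≤ ((168042 / 10000000 : ℚ) : ℝ) := by
  have hax : ∀ m : ℤ, 3 ≤ m.natAbs → srwU 10 3 0 (Pi.single (0 : Fin 10) m) ≤ ((168042 / 10000000 : ℚ) : ℝ) :=
    axisFamily_of_cell_le_of_succ (uInv 3 0) 0 (m₀ := 3) (srwU_zero_cell_d10_n3_m3 0)
      (Rat.cast_le.mpr (by norm_num)) <|
    axisFamily_of_cell_le_of_succ (uInv 3 0) 0 (m₀ := 4) (srwU_zero_cell_d10_n3_m4 0)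
      (Rat.cast_le.mpr (by norm_num)) <|
    axisFamily_of_cell_le_of_succ (uInv 3 0) 0 (m₀ := 5) (srwU_zero_cell_d10_n3_m5 0)
      (Rat.cast_le.mpr (by norm_num)) <|
    axisFamily_of_uniform_le (F := srwU 10 3 0) 0 (M := 6)
      (fun m hm => srwU_zero_far6_d10_n3 0 m hm) (Rat.cast_le.mpr (by norm_num))
  have h := srwU_le_of_axisFamily_nodeBounds_three_cast (d := 10) (n := 3) (by norm_num) (by norm_num) 0 (0 : Fin 10)
    (B := bThree 3) (q := (168042 / 10000000 : ℚ)) hax (vUp_sound (n := 3) (by norm_num) (by norm_num) (l := 0) (by norm_num))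
    ((us_srwL_two_one_le (n := 3) (by norm_num) (by norm_num)).trans (Rat.cast_le.mpr (by decide +kernel)))
    ((us_srwL_two_two_le (n := 3) (by norm_num) (by norm_num)).trans (Rat.cast_le.mpr (by decide +kernel)))
    (fun r hr3 hr => (srwL_classVec_le_wOnes (n := 3) (by norm_num) (by norm_num) (by omega) hr).trans
      (Rat.cast_le.mpr (us_wOnes_le_bThree 3 (by norm_num) r hr hr3)))
    (by norm_num) (by decide +kernel) x hx
  simpa only [max_self] using h

/-- **`U_{4,0}(x; 10) ≤ 0.0244540` whenever `Σ_μ |x_μ| ≥ 3`** (binding constraint: tail6; `TUSupD10.uS3 4 0` = 0.0254390,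
-3.87 %).  Constraints: cell3 0.0218870, cell4 0.0232910, cell5 0.0232780, tail6 0.0244540, cone 0.0206865. [cite: FitznerVanDerHofstad2016NoBLE, (3.38) p. 1071, §5.2 (5.9) p. 1091, (5.15)–(5.16) p. 1092, §5.1 p. 1093] -/
theorem srwU_zero_le_of_three_le_d10_n4 (x : Fin 10 → ℤ) (hx : 3 ≤ ∑ μ, |x μ|) :
    srwU 10 4 0 x ≤ ((244540 / 10000000 : ℚ) : ℝ) := by
  have hax : ∀ m : ℤ, 3 ≤ m.natAbs → srwU 10 4 0 (Pi.single (0 : Fin 10) m) ≤ ((244540 / 10000000 : ℚ) : ℝ) :=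
    axisFamily_of_cell_le_of_succ (uInv 4 0) 0 (m₀ := 3) (srwU_zero_cell_d10_n4_m3 0)
      (Rat.cast_le.mpr (by norm_num)) <|
    axisFamily_of_cell_le_of_succ (uInv 4 0) 0 (m₀ := 4) (srwU_zero_cell_d10_n4_m4 0)
      (Rat.cast_le.mpr (by norm_num)) <|
    axisFamily_of_cell_le_of_succ (uInv 4 0) 0 (m₀ := 5) (srwU_zero_cell_d10_n4_m5 0)
      (Rat.cast_le.mpr (by norm_num)) <|
    axisFamily_of_uniform_le (F := srwU 10 4 0) 0 (M := 6)
      (fun m hm => srwU_zero_far6_d10_n4 0 m hm) (Rat.cast_le.mpr (by norm_num))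
  have h := srwU_le_of_axisFamily_nodeBounds_three_cast (d := 10) (n := 4) (by norm_num) (by norm_num) 0 (0 : Fin 10)
    (B := bThree 4) (q := (244540 / 10000000 : ℚ)) hax (vUp_sound (n := 4) (by norm_num) (by norm_num) (l := 0) (by norm_num))
    ((us_srwL_two_one_le (n := 4) (by norm_num) (by norm_num)).trans (Rat.cast_le.mpr (by decide +kernel)))
    ((us_srwL_two_two_le (n := 4) (by norm_num) (by norm_num)).trans (Rat.cast_le.mpr (by decide +kernel)))
    (fun r hr3 hr => (srwL_classVec_le_wOnes (n := 4) (by norm_num) (by norm_num) (by omega) hr).trans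
      (Rat.cast_le.mpr (us_wOnes_le_bThree 4 (by norm_num) r hr hr3)))
    (by norm_num) (by decide +kernel) x hx
  simpa only [max_self] using h


end USupKUSepD10

end Literature.Probability.FitznerVanDerHofstad2017
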